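import Literature.NumberTheory.EllipticCurves.ModularCurve
import Literature.NumberTheory.EllipticCurves.QuadraticTwist
import Literature.NumberTheory.EllipticCurves.GlobalMinimalModel
import Literature.NumberTheory.DiophantineGeometry.Conductor
import Mathlib.NumberTheory.Padics.PadicVal.Basic
import HarnessLib
import HarnessLib.Audit.Tags

/-!
# Candidates E-an-35 `TwoTwistCommutingOrbitDiscrDirection d` and E-an-36 `TwoTwistCommutingOrbitManinValEq d`
# — the DISCRIMINANT DIRECTION LAW and 2-ADIC MANIN INVARIANCE on commuting optimal `χ±8`-twists —
# cell `bsd-f2-manin`, `@[conjecture]` leaves (NOTHING asserted; definitions only; proved edges in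
# `TwistOrbitManinNearInvarianceAtTwo.lean` / `TwistOrbitManinNearInvarianceAtTwoEdges.lean`).

LENS = analytic / period-lattice (planner `bsd-f2-manin-an` g6, MEMO-an §47; decls VERBATIM from HOME
`run/shared/lean/pub/bsd-f2-manin/an/NearInvarianceAtTwo-combined-g6.lean`, farm rc 0 · 0 errors · 0 warnings ·
0 sorries).  Informal law (E-an-35): «on a COMMUTING optimal `±2`-pair at `2` with `2⁶ ∣ N = N′` (`W`, `W′`
globally minimal, `D`, `D′` lattice-optimal at the conductor levels, `u • (W ⊗ d) = W′`, `d = ±2`), if the modular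
degree goes UP (`deg′ = 2·deg`) then the minimal discriminant goes UP (`v₂Δ_min′ = v₂Δ_min + 6`)» — NO Manin
constant in it; in Kodaira terms (`v₂(N) ∈ {7, 8}`, same conductor exponent ⇒ `m′ − m = v₂Δ′ − v₂Δ`): the STARRED
member (`I₂*` resp. `III*` versus `II` resp. `III`) has the doubled degree.  E-an-36: `v₂(c′) = v₂(c)` on the same
pairs.  By the PROVED `twoTwistCommutingOrbitManinValEq_iff_discrDirection` the two are EQUIVALENT; unconditionally
`|v₂ c′ − v₂ c| ≤ 1` there (`twoTwistCommutingOrbitManinValNear_holds`).  BC5: `(Δ_deg, Δv₂Δ) ∈ {(+1,+6), (−1,−6)}`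
on 28 112 / 28 112 commuting same-conductor `χ₈` rows and 28 112 / 28 112 `χ₋₈` rows of TWISTCENSUS2 v1
43352cbe215eb58a (non-CM, N ≤ 500 000; `v₂(N) = 7`: 19 660 + 19 660, `v₂(N) = 8`: 8 452 + 8 452); cheapest
falsifier = ONE commuting optimal `χ±8` pair with `deg′ = 2·deg ∧ v₂Δ′ = v₂Δ − 6`: 0 found.  Guard
`d = 2 ∨ d = −2 →` (vacuous at every other `d`; the refuted unguarded odd schema `CommutingOrbitDiscrDirection 1`
is the precedent).  Beyond-print theorem: NO (laws, i.e. conjectures; Edixhoven 1991 §4 treats `p > 7` only).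
REFUTER VERDICTS (cell record): REF1 R-an-20 = HOME/REFUTER-ref1.md §R35 (2026-08-27T23:12Z; probe files
HOME/ref1-C42-an-g6.lean 11f57d4295f9a515, ref1-C42L-an-g6-leafL.lean 7a9799eee134dfac): E-an-35 SURVIVES, E-an-36 SURVIVES
(BC7 CLEAN ×2 each; guard / junk / lattice-clause audit; non-vacuity witnesses 2432a1 ⊗ χ₈ → 2432d1, 3328d1 → 3328b1;
falsifier hits 0 / 56 224; KILLED 0, misstated 0); REF2 R-an-21 (HOME/ref2/LIT-PLACEMENT v8 §D⁸): the direction law /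
near-invariance at `2` NOT-IN-PRINT (variant of the `p > 7` comparison of Edixhoven 1991 §4), laws OPEN-NEW.  This file =
HOME/an/TwoTwistCommutingOrbitDiscrDirection-g6.lean 557a6e4e75720649 verbatim + this paragraph.
[cite: Watkins2002, §2.1] [cite: EdixhovenManin1991, §4 (pp. 12–13)]
-/

noncomputable section

open scoped MatrixGroups ModularForm

open CongruenceSubgroup WeierstrassCurve
  Literature.NumberTheory.DiophantineGeometry
  Literature.NumberTheory.EllipticCurves
  Literature.NumberTheory.EllipticCurves.ModularForms

namespace Summit.BirchSwinnertonDyer.Rank1Residual.ManinAdditive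

/-- **TYPED LEAF E-an-35 `TwoTwistCommutingOrbitDiscrDirection d` (cell bsd-f2-manin; a LAW — nothing
asserted): the DISCRIMINANT DIRECTION LAW AT `2`** — on a commuting optimal `χ±8`-pair (`d = ±2`,
`2⁶ ∣ N = N′`, both data lattice-optimal, both equations globally minimal) the member of DOUBLED modular degree
is the one whose minimal discriminant is LARGER by `2⁶` (equivalently, by `twoTwistCommutingOrbitManinValEq_iff_discrDirection`,
2-adic Manin invariance along the pair; in Kodaira terms at `v₂(N) ∈ {7, 8}`: the starred member `I₂*` / `III*`
has the doubled degree).  Census TWISTCENSUS2 v1 (N ≤ 500 000, non-CM): 28 112 / 28 112 commuting same-conductor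
`χ₈` rows and 28 112 / 28 112 `χ₋₈` rows have `(Δdeg, v₂Δ′ − v₂Δ) ∈ {(+1, +6), (−1, −6)}`.  Guard
`d = 2 ∨ d = −2 →`.  [cite: Watkins2002, §2.1] -/
@[conjecture] def TwoTwistCommutingOrbitDiscrDirection (d : ℤ) : Prop :=
  d = 2 ∨ d = -2 →
  ∀ (W W' : WeierstrassCurve ℚ) [W.IsElliptic] [W.IsGloballyMinimal] [W'.IsElliptic]
    [W'.IsGloballyMinimal] [NeZero (W.conductorNorm ℤ)] [NeZero (W'.conductorNorm ℤ)]
    (u : VariableChange ℚ) (D : ModularParametrizationData W (W.conductorNorm ℤ))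
    (D' : ModularParametrizationData W' (W'.conductorNorm ℤ)),
    (∀ z ∈ D.L.lattice, ∃ w ∈ periodLattice D.f, z = D.c * w) →
    (∀ z ∈ D'.L.lattice, ∃ w ∈ periodLattice D'.f, z = D'.c * w) →
    2 ^ 6 ∣ W.conductorNorm ℤ → W'.conductorNorm ℤ = W.conductorNorm ℤ →
    u • W.quadraticTwist ((d : ℤ) : ℚ) = W' →
    D'.modularDegree = 2 * D.modularDegree →
    padicValInt 2 W'.minimalDiscriminantInt = padicValInt 2 W.minimalDiscriminantInt + 6
/-- **TYPED LEAF E-an-36 `TwoTwistCommutingOrbitManinValEq d` (cell bsd-f2-manin; a LAW — nothing asserted):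
2-ADIC MANIN INVARIANCE along commuting optimal `χ±8`-pairs** (`d = ±2`, `2⁶ ∣ N = N′`): `v₂(c′) = v₂(c)`
(a consequence of Manin's conjecture `c = ±1` for optimal curves; open at additive `2`).  Guard
`d = 2 ∨ d = −2 →`. [cite: Watkins2002, §2.1] -/
@[conjecture] def TwoTwistCommutingOrbitManinValEq (d : ℤ) : Prop :=
  d = 2 ∨ d = -2 →
  ∀ (W W' : WeierstrassCurve ℚ) [W.IsElliptic] [W.IsGloballyMinimal] [W'.IsElliptic]
    [W'.IsGloballyMinimal] [NeZero (W.conductorNorm ℤ)] [NeZero (W'.conductorNorm ℤ)]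
    (u : VariableChange ℚ) (D : ModularParametrizationData W (W.conductorNorm ℤ))
    (D' : ModularParametrizationData W' (W'.conductorNorm ℤ)),
    (∀ z ∈ D.L.lattice, ∃ w ∈ periodLattice D.f, z = D.c * w) →
    (∀ z ∈ D'.L.lattice, ∃ w ∈ periodLattice D'.f, z = D'.c * w) →
    2 ^ 6 ∣ W.conductorNorm ℤ → W'.conductorNorm ℤ = W.conductorNorm ℤ →
    u • W.quadraticTwist ((d : ℤ) : ℚ) = W' →
    padicValInt 2 D'.c = padicValInt 2 D.c

end Summit.BirchSwinnertonDyer.Rank1Residual.ManinAdditive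

end
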